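import Summits.PneNP.PneNP.Theses.SymmetryBudget
import Summits.PneNP.PneNP.Theses.Circuit
import Summits.PneNP.PneNP.Theorems.SymmetryBudgetWindowHamIffNPNotSubsetPPoly
import Summits.PneNP.PneNP.Theorems.SymmetryBudgetRigidBenchmarkSummit

/-!
# Crux links BY NAME: `WindowHam` (stmt-PneNP-2143) = `CircuitThesis` (stmt-PneNP-10624) = `RigidBenchmark` (stmt-PneNP-2149)

The calibrations landed in `SymmetryBudgetWindowHamIffNPNotSubsetPPoly.lean` (p127107) and
`SymmetryBudgetRigidBenchmarkSummit.lean` (p99107) relate route `SymmetryBudget`'s crux `WindowHam` and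
its support `RigidBenchmark` to the conjecture leaf `Summit.PneNP.PneNP.NPNotSubsetPPoly`. Route
`Circuit`'s crux `Summit.PneNP.PneNP.Theses.Circuit.CircuitThesis` is, by `Iff.rfl`, the same statement
`¬ (NP ⊆ P/poly)` — but no theorem in the tree mentions the three ROUTE ITEM DECLS together by their
exact names, which is how the obligation graph reads edges. This file states those edges and nothing
else: each item of the triple is `closed modulo` either of the other two (and, the links being `Iff`s,
a refutation of one refutes all three). No direction is asserted unconditionally (all three are
`NP ⊄ P/poly`, open).
-/

-- `Summit.PneNP.PneNP.…` duplicates `PneNP` BY DESIGN (single-problem summit, D-0017).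
set_option linter.dupNamespace false

namespace Summit.PneNP.PneNP.Theorems

open Summit.PneNP.PneNP.Theses.SymmetryBudget (WindowHam RigidBenchmark)
open Summit.PneNP.PneNP.Theses.Circuit (CircuitThesis)

/-- **stmt-PneNP-2143 ↔ stmt-PneNP-10624.** Route `SymmetryBudget`'s crux `WindowHam` is equivalent to
route `Circuit`'s crux `CircuitThesis` (`¬ (NP ⊆ P/poly)`), by `windowHam_iff_not_np_subset_PPoly`. -/
theorem windowHam_iff_circuitThesis : WindowHam ↔ CircuitThesis :=
  windowHam_iff_not_np_subset_PPoly

/-- `CircuitThesis → WindowHam`: stmt-PneNP-2143 is closed modulo stmt-PneNP-10624. -/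
theorem windowHam_of_circuitThesis (h : CircuitThesis) : WindowHam :=
  windowHam_iff_circuitThesis.2 h

/-- `WindowHam → CircuitThesis`: stmt-PneNP-10624 is closed modulo stmt-PneNP-2143. -/
theorem circuitThesis_of_windowHam (h : WindowHam) : CircuitThesis :=
  windowHam_iff_circuitThesis.1 h

/-- **stmt-PneNP-2149 ↔ stmt-PneNP-10624.** Route `SymmetryBudget`'s support `RigidBenchmark` is
equivalent to route `Circuit`'s crux `CircuitThesis`, by `rigidBenchmark_iff_npNotSubsetPPoly`. -/
theorem rigidBenchmark_iff_circuitThesis : RigidBenchmark ↔ CircuitThesis :=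
  rigidBenchmark_iff_npNotSubsetPPoly

/-- `CircuitThesis → RigidBenchmark`: stmt-PneNP-2149 is closed modulo stmt-PneNP-10624. -/
theorem rigidBenchmark_of_circuitThesis (h : CircuitThesis) : RigidBenchmark :=
  rigidBenchmark_iff_circuitThesis.2 h

/-- `RigidBenchmark → CircuitThesis`: stmt-PneNP-10624 is closed modulo stmt-PneNP-2149. -/
theorem circuitThesis_of_rigidBenchmark (h : RigidBenchmark) : CircuitThesis :=
  rigidBenchmark_iff_circuitThesis.1 h

/-- **stmt-PneNP-2143 ↔ stmt-PneNP-2149.** Within route `SymmetryBudget`, the crux `WindowHam` (HAM,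
rank 2) and the support `RigidBenchmark` (3-COL on rigid inputs, rank 12) are one and the same
obligation. -/
theorem windowHam_iff_rigidBenchmark : WindowHam ↔ RigidBenchmark :=
  windowHam_iff_circuitThesis.trans rigidBenchmark_iff_circuitThesis.symm

/-- `RigidBenchmark → WindowHam`: stmt-PneNP-2143 is closed modulo stmt-PneNP-2149. -/
theorem windowHam_of_rigidBenchmark (h : RigidBenchmark) : WindowHam :=
  windowHam_iff_rigidBenchmark.2 h

/-- `WindowHam → RigidBenchmark`: stmt-PneNP-2149 is closed modulo stmt-PneNP-2143. -/
theorem rigidBenchmark_of_windowHam (h : WindowHam) : RigidBenchmark :=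
  windowHam_iff_rigidBenchmark.1 h

end Summit.PneNP.PneNP.Theorems
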